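import Mathlib
import Literature.Analysis.FluidPDE.Tao2016AveragedNS.BoundedEternalSolutions
import HarnessLib

/-!
# `WakeRatchet.TailRatchet` (stmt-NavierStokesRegularity-21808): SMALL bounded eternal solutions of the
# renormalised lattice have SUMMABLE shell actions — the eternal-solution form of the DSS amplitude floor

Support file for the crux `TailRatchet` (route `WakeRatchet`; MODEL lattice ODEs of Tao 2016 §4 —
nothing in this file is a statement about the Navier–Stokes equations, and no item is closed here).

The crux quantifies over uniformly bounded admissible eternal solutions `W` (`IsEternal ε₀ α W`,
`‖W_n(σ)‖ ≤ C`).  Companion file `WakeRatchetTailRatchetDSSAmplitudeFloor`: a non-trivial admissible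
DSS wave has renormalised amplitude `≳ 1/((Λ − Λ⁻¹)·fluxConst α) ≍ ε₀⁻¹`.  Here the same global
energy balance is run SHELL-WISE for an arbitrary (not necessarily self-similar) bounded admissible
INVISCID eternal solution of a cancelling table:

* `hasDerivAt_norm_sq` — `d/dσ ‖W_n‖² = −2‖W_n‖² + 2Λ⟪W_n, A W_{n−1}⟫ − 2Λ⁻¹⟪W_{n+1}, A W_n⟫`
  (cancellation (4.3); the unweighted form of the tree's `hasDerivAt_renE`);
* `integral_norm_sq_eq` — the SHELL BALANCE `∫‖W_n‖² = Λ·I_{n−1} − Λ⁻¹·I_n`,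
  `I_n := ∫⟪W_{n+1}, A W_n⟫` (renormalised action-flux through the bond `n → n+1`), with
  `|I_n| ≤ fluxConst α · C · ∫‖W_n‖²` (`abs_integral_flux_le`);
* `block_sum_le` — telescoping over a block of shells:
  `(1 − θ) Σ_{k<N} ∫‖W_{a+k}‖² ≤ Λ · fluxConst α · C · (∫‖W_{a−1}‖² + ∫‖W_{a+N−1}‖²)`,
  `θ := (Λ − Λ⁻¹) · fluxConst α · C`;
* `summable_action_sq` / `tendsto_action_sq_cofinite` — if `θ < 1` (a SMALL type-I constant,
  `C < 1/((Λ−Λ⁻¹) fluxConst α) ≍ 1/(5 ε₀ · fluxConst α)`), then `n ↦ ∫‖W_n‖²` is summable over `ℤ`,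
  so `∫‖W_n‖² → 0` as `n → ±∞`: a small bounded eternal solution is EVANESCENT in both shell
  directions.  For a DSS-carried solution (`∫‖W_n‖²` independent of `n`) this is triviality again.

READING FOR THE CENSUS of stmt-21808: any bounded admissible eternal solution that could witness
`¬TailRatchet` at fine scale ratio with an `ε₀`-INDEPENDENT type-I bound has shell actions tending to
zero in the far past (`n → −∞`) — it cannot be a front of asymptotically constant strength fed from
`n = −∞`; persistent fronts (DSS or not) must have `sup‖W‖ ≳ ε₀⁻¹`.

HONEST FRAMING: elementary real analysis on the cell's lemma layer; MODEL lattice only.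
-/

noncomputable section

set_option linter.dupNamespace false

namespace Summit.NavierStokesRegularity.NavierStokesRegularity.Theorems

namespace WakeRatchetEternalActionSummable

open MeasureTheory Set Filter Topology
open scoped RealInnerProductSpace
open Literature.Analysis.FluidPDE Literature.Analysis.FluidPDE.TaoCascade

variable {m : ℕ} {ε₀ : ℝ} {α : Fin m → Fin m → Fin m → ℤ × ℤ × ℤ → ℝ} {W : ℤ → ℝ → Em m}

/-- Shells of an admissible eternal solution are continuous in log-time. [cite: Tao2016AveragedNS, §4 Lemma 4.1 (4.8); cell lemma] -/
theorem continuous_shell (hW : IsEternal ε₀ α W) (n : ℤ) : Continuous (W n) :=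
  continuous_iff_continuousAt.2 fun x => (hW.law n x).continuousAt

/-- **Unweighted shell energy identity** (inviscid): `d/dσ ‖W_n‖² = −2‖W_n‖² + 2Λ⟪W_n, A W_{n−1}⟫ −
2Λ⁻¹⟪W_{n+1}, A W_n⟫` — the intra-shell term is neutral and cancellation (4.3) turns the back-reaction
pairing into minus the outgoing flux pairing.
[cite: Tao2016AveragedNS, §4 (4.3), Lemma 4.1 (4.8)–(4.10) in the self-similar variables of §6.4; cell lemma] -/
theorem hasDerivAt_norm_sq (hW : IsEternal ε₀ α W) (hc : IsCancellingCoeff α) (n : ℤ) (σ : ℝ) :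
    HasDerivAt (fun x => ‖W n x‖ ^ 2)
      (-2 * ‖W n σ‖ ^ 2 + 2 * bigLam ε₀ * ⟪W n σ, tableA α (W (n - 1) σ)⟫
        - 2 * (bigLam ε₀)⁻¹ * ⟪W (n + 1) σ, tableA α (W n σ)⟫) σ := by
  have hS := table_sTable α hc
  refine ((hW.law n σ).norm_sq).congr_deriv ?_
  rw [inner_add_right, inner_add_right, inner_add_right, inner_neg_right, real_inner_smul_right,
    real_inner_smul_right, real_inner_smul_right, real_inner_self_eq_norm_sq, hS.intra]
  have hcan := hS.cancel (W n σ) (W (n + 1) σ)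
  linear_combination (2 * (bigLam ε₀)⁻¹) * hcan

/-- `σ ↦ ‖W_n(σ)‖²` is integrable for a bounded admissible eternal solution (`‖W_n‖² ≤ C‖W_n‖`).
[cite: Tao2016AveragedNS, §4 Lemma 4.1 (4.8); cell lemma] -/
theorem integrable_norm_sq (hW : IsEternal ε₀ α W) {C : ℝ} (hC : ∀ k σ, ‖W k σ‖ ≤ C) (n : ℤ) :
    Integrable (fun σ => ‖W n σ‖ ^ 2) := by
  obtain ⟨M, hM⟩ := hW.action
  refine Integrable.mono' ((hM n).1.const_mul C)
    (((continuous_shell hW n).norm.pow 2).aestronglyMeasurable) (Eventually.of_forall fun σ => ?_)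
  rw [Real.norm_eq_abs, abs_of_nonneg (by positivity), sq]
  exact mul_le_mul_of_nonneg_right (hC n σ) (norm_nonneg _)

/-- Pointwise flux bound `|⟪W_{n+1}, A W_n⟫| ≤ fluxConst α · C · ‖W_n‖²`.
[cite: Tao2016AveragedNS, §4 (4.1), Lemma 4.1 (4.9); cell lemma] -/
theorem abs_flux_le (hc : IsCancellingCoeff α) {C : ℝ} (hC : ∀ k σ, ‖W k σ‖ ≤ C) (n : ℤ) (σ : ℝ) :
    |⟪W (n + 1) σ, tableA α (W n σ)⟫| ≤ fluxConst α * C * ‖W n σ‖ ^ 2 := by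
  have hS := table_sTable α hc
  calc |⟪W (n + 1) σ, tableA α (W n σ)⟫| ≤ ‖W (n + 1) σ‖ * ‖tableA α (W n σ)‖ :=
        abs_real_inner_le_norm _ _
    _ ≤ C * (fluxConst α * ‖W n σ‖ ^ 2) :=
        mul_le_mul (hC _ _) (hS.normA _) (norm_nonneg _) ((norm_nonneg _).trans (hC (n + 1) σ))
    _ = fluxConst α * C * ‖W n σ‖ ^ 2 := by ring

/-- The flux pairing `σ ↦ ⟪W_{n+1}, A W_n⟫` is integrable.
[cite: Tao2016AveragedNS, §4 (4.1), Lemma 4.1 (4.9); cell lemma] -/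
theorem integrable_flux (hW : IsEternal ε₀ α W) (hc : IsCancellingCoeff α) {C : ℝ}
    (hC : ∀ k σ, ‖W k σ‖ ≤ C) (n : ℤ) :
    Integrable (fun σ => ⟪W (n + 1) σ, tableA α (W n σ)⟫) := by
  have hS := table_sTable α hc
  refine Integrable.mono' ((integrable_norm_sq hW hC n).const_mul (fluxConst α * C))
    (((continuous_shell hW (n + 1)).inner (hS.contA.comp (continuous_shell hW n))).aestronglyMeasurable)
    (Eventually.of_forall fun σ => ?_)
  rw [Real.norm_eq_abs]
  exact abs_flux_le hc hC n σ

/-- `|∫⟪W_{n+1}, A W_n⟫| ≤ fluxConst α · C · ∫‖W_n‖²`. [cite: Tao2016AveragedNS, §4 Lemma 4.1 (4.9); cell lemma] -/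
theorem abs_integral_flux_le (hW : IsEternal ε₀ α W) (hc : IsCancellingCoeff α) {C : ℝ}
    (hC : ∀ k σ, ‖W k σ‖ ≤ C) (n : ℤ) :
    |∫ σ, ⟪W (n + 1) σ, tableA α (W n σ)⟫| ≤ fluxConst α * C * ∫ σ, ‖W n σ‖ ^ 2 := by
  calc |∫ σ, ⟪W (n + 1) σ, tableA α (W n σ)⟫| ≤ ∫ σ, |⟪W (n + 1) σ, tableA α (W n σ)⟫| := by
        simpa only [Real.norm_eq_abs] using
          norm_integral_le_integral_norm (fun σ => ⟪W (n + 1) σ, tableA α (W n σ)⟫)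
    _ ≤ ∫ σ, fluxConst α * C * ‖W n σ‖ ^ 2 :=
        integral_mono (integrable_flux hW hc hC n).abs ((integrable_norm_sq hW hC n).const_mul _)
          fun σ => abs_flux_le hc hC n σ
    _ = fluxConst α * C * ∫ σ, ‖W n σ‖ ^ 2 := integral_const_mul _ _

/-- **Shell balance.**  `∫‖W_n‖² = Λ ∫⟪W_n, A W_{n−1}⟫ − Λ⁻¹ ∫⟪W_{n+1}, A W_n⟫`: the renormalised
`L²`-action of a shell is the weighted difference of the action-fluxes through its two bonds.
[cite: Tao2016AveragedNS, §4 (4.3), Lemma 4.1 (4.9)–(4.10), §6.4; cell theorem] -/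
theorem integral_norm_sq_eq (hW : IsEternal ε₀ α W) (hc : IsCancellingCoeff α) {C : ℝ}
    (hC : ∀ k σ, ‖W k σ‖ ≤ C) (n : ℤ) :
    ∫ σ, ‖W n σ‖ ^ 2 = bigLam ε₀ * (∫ σ, ⟪W n σ, tableA α (W (n - 1) σ)⟫)
      - (bigLam ε₀)⁻¹ * ∫ σ, ⟪W (n + 1) σ, tableA α (W n σ)⟫ := by
  have hE := integrable_norm_sq hW hC n
  have hF := integrable_flux hW hc hC n
  have hFm : Integrable (fun σ => ⟪W n σ, tableA α (W (n - 1) σ)⟫) := by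
    have h := integrable_flux hW hc hC (n - 1)
    simp only [sub_add_cancel] at h
    exact h
  have i1 : Integrable (fun σ => -2 * ‖W n σ‖ ^ 2) := hE.const_mul _
  have i2 : Integrable (fun σ => 2 * bigLam ε₀ * ⟪W n σ, tableA α (W (n - 1) σ)⟫) := hFm.const_mul _
  have i3 : Integrable (fun σ => 2 * (bigLam ε₀)⁻¹ * ⟪W (n + 1) σ, tableA α (W n σ)⟫) :=
    hF.const_mul _
  have h0 := integral_eq_zero_of_hasDerivAt_of_integrable (hasDerivAt_norm_sq hW hc n)
    ((i1.add i2).sub i3) hE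
  have h1 : ∫ σ, (-2 * ‖W n σ‖ ^ 2 + 2 * bigLam ε₀ * ⟪W n σ, tableA α (W (n - 1) σ)⟫
      - 2 * (bigLam ε₀)⁻¹ * ⟪W (n + 1) σ, tableA α (W n σ)⟫)
      = (∫ σ, (-2 * ‖W n σ‖ ^ 2 + 2 * bigLam ε₀ * ⟪W n σ, tableA α (W (n - 1) σ)⟫))
        - ∫ σ, 2 * (bigLam ε₀)⁻¹ * ⟪W (n + 1) σ, tableA α (W n σ)⟫ := integral_sub (i1.add i2) i3
  have h2 : ∫ σ, (-2 * ‖W n σ‖ ^ 2 + 2 * bigLam ε₀ * ⟪W n σ, tableA α (W (n - 1) σ)⟫)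
      = (∫ σ, -2 * ‖W n σ‖ ^ 2) + ∫ σ, 2 * bigLam ε₀ * ⟪W n σ, tableA α (W (n - 1) σ)⟫ :=
    integral_add i1 i2
  rw [h1, h2, integral_const_mul, integral_const_mul, integral_const_mul] at h0
  linarith

/-- Shifted-block bookkeeping: `Σ_{k<N} I(a−1+k) = Σ_{k<N} I(a+k) + I(a−1) − I(a+N−1)`. [folklore] -/
theorem sum_shift_pred (I : ℤ → ℝ) (a : ℤ) (N : ℕ) :
    ∑ k ∈ Finset.range N, I (a - 1 + k) = ∑ k ∈ Finset.range N, I (a + k) + I (a - 1) - I (a + N - 1) := by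
  induction N with
  | zero => simp
  | succ N ih =>
    rw [Finset.sum_range_succ, Finset.sum_range_succ, ih]
    have e1 : a - 1 + (N : ℤ) = a + N - 1 := by ring
    have e2 : a + ((N + 1 : ℕ) : ℤ) - 1 = a + N := by push_cast; ring
    rw [e1, e2]
    ring

/-- **Block inequality.**  For a bounded admissible inviscid eternal solution of a cancelling table at
scale ratio `1+ε₀`, `0 ≤ ε₀`, and every block of shells `a, …, a+N−1`:
`(1 − (Λ−Λ⁻¹)·fluxConst α·C) · Σ_{k<N} ∫‖W_{a+k}‖² ≤ Λ·fluxConst α·C·(∫‖W_{a−1}‖² + ∫‖W_{a+N−1}‖²)` —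
the total `L²`-action of a block is controlled by its two boundary shells once the type-I constant is
small. [cite: Tao2016AveragedNS, §4 (4.1)–(4.3), Lemma 4.1 (4.9)–(4.10), §6.4; cell theorem] -/
theorem block_sum_le (hε : 0 ≤ ε₀) (hW : IsEternal ε₀ α W) (hc : IsCancellingCoeff α) {C : ℝ}
    (hC : ∀ k σ, ‖W k σ‖ ≤ C) (a : ℤ) (N : ℕ) :
    (1 - (bigLam ε₀ - (bigLam ε₀)⁻¹) * fluxConst α * C) *
        ∑ k ∈ Finset.range N, ∫ σ, ‖W (a + k) σ‖ ^ 2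
      ≤ bigLam ε₀ * fluxConst α * C *
        ((∫ σ, ‖W (a - 1) σ‖ ^ 2) + ∫ σ, ‖W (a + N - 1) σ‖ ^ 2) := by
  set I : ℤ → ℝ := fun n => ∫ σ, ⟪W (n + 1) σ, tableA α (W n σ)⟫ with hI
  set J : ℤ → ℝ := fun n => ∫ σ, ‖W n σ‖ ^ 2 with hJ
  have hΛ1 : 1 ≤ bigLam ε₀ := one_le_bigLam hε
  have hΛ0 : 0 < bigLam ε₀ := by linarith
  have hK0 : 0 ≤ fluxConst α * C := by
    have h1 : 0 ≤ fluxConst α := (table_sTable α hc).CA_nonneg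
    have h2 : 0 ≤ C := (norm_nonneg _).trans (hC 0 0)
    positivity
  -- shell balance in the `I`/`J` bookkeeping
  have hbal : ∀ n : ℤ, J n = bigLam ε₀ * I (n - 1) - (bigLam ε₀)⁻¹ * I n := by
    intro n
    have h := integral_norm_sq_eq hW hc hC n
    simp only [hI, hJ, sub_add_cancel]
    exact h
  have hIJ : ∀ n : ℤ, |I n| ≤ fluxConst α * C * J n := fun n => abs_integral_flux_le hW hc hC n
  have hJ0 : ∀ n : ℤ, 0 ≤ J n := fun n => integral_nonneg fun σ => by positivity
  -- telescoping over the block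
  have hsum : ∑ k ∈ Finset.range N, J (a + k)
      = (bigLam ε₀ - (bigLam ε₀)⁻¹) * ∑ k ∈ Finset.range N, I (a + k)
        + bigLam ε₀ * (I (a - 1) - I (a + N - 1)) := by
    have h1 : ∑ k ∈ Finset.range N, J (a + k)
        = bigLam ε₀ * ∑ k ∈ Finset.range N, I (a - 1 + k)
          - (bigLam ε₀)⁻¹ * ∑ k ∈ Finset.range N, I (a + k) := by
      rw [Finset.mul_sum, Finset.mul_sum, ← Finset.sum_sub_distrib]
      refine Finset.sum_congr rfl fun k _ => ?_
      rw [hbal (a + k), show a + (k : ℤ) - 1 = a - 1 + k by ring]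
    rw [h1, sum_shift_pred I a N]
    ring
  -- bound the right-hand side
  have hIsum : |∑ k ∈ Finset.range N, I (a + k)| ≤ fluxConst α * C * ∑ k ∈ Finset.range N, J (a + k) := by
    calc |∑ k ∈ Finset.range N, I (a + k)| ≤ ∑ k ∈ Finset.range N, |I (a + k)| :=
          Finset.abs_sum_le_sum_abs _ _
      _ ≤ ∑ k ∈ Finset.range N, fluxConst α * C * J (a + k) :=
          Finset.sum_le_sum fun k _ => hIJ (a + k)
      _ = fluxConst α * C * ∑ k ∈ Finset.range N, J (a + k) := by rw [Finset.mul_sum]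
  have hnn : 0 ≤ bigLam ε₀ - (bigLam ε₀)⁻¹ := by
    have : (bigLam ε₀)⁻¹ ≤ 1 := inv_le_one_of_one_le₀ hΛ1
    linarith
  have hb1 : (bigLam ε₀ - (bigLam ε₀)⁻¹) * ∑ k ∈ Finset.range N, I (a + k)
      ≤ (bigLam ε₀ - (bigLam ε₀)⁻¹) * (fluxConst α * C * ∑ k ∈ Finset.range N, J (a + k)) :=
    mul_le_mul_of_nonneg_left ((le_abs_self _).trans hIsum) hnn
  have hb2 : bigLam ε₀ * (I (a - 1) - I (a + N - 1))
      ≤ bigLam ε₀ * (fluxConst α * C * J (a - 1) + fluxConst α * C * J (a + N - 1)) := by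
    refine mul_le_mul_of_nonneg_left ?_ hΛ0.le
    have h1 := (le_abs_self _).trans (hIJ (a - 1))
    have h2 := (neg_le_abs _).trans (hIJ (a + N - 1))
    linarith
  have key : ∑ k ∈ Finset.range N, J (a + k)
      ≤ (bigLam ε₀ - (bigLam ε₀)⁻¹) * fluxConst α * C * ∑ k ∈ Finset.range N, J (a + k)
        + bigLam ε₀ * fluxConst α * C * (J (a - 1) + J (a + N - 1)) := by
    calc ∑ k ∈ Finset.range N, J (a + k)
        = (bigLam ε₀ - (bigLam ε₀)⁻¹) * ∑ k ∈ Finset.range N, I (a + k)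
          + bigLam ε₀ * (I (a - 1) - I (a + N - 1)) := hsum
      _ ≤ (bigLam ε₀ - (bigLam ε₀)⁻¹) * (fluxConst α * C * ∑ k ∈ Finset.range N, J (a + k))
          + bigLam ε₀ * (fluxConst α * C * J (a - 1) + fluxConst α * C * J (a + N - 1)) :=
          add_le_add hb1 hb2
      _ = (bigLam ε₀ - (bigLam ε₀)⁻¹) * fluxConst α * C * ∑ k ∈ Finset.range N, J (a + k)
          + bigLam ε₀ * fluxConst α * C * (J (a - 1) + J (a + N - 1)) := by ring
  show (1 - (bigLam ε₀ - (bigLam ε₀)⁻¹) * fluxConst α * C) * ∑ k ∈ Finset.range N, J (a + k)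
      ≤ bigLam ε₀ * fluxConst α * C * (J (a - 1) + J (a + N - 1))
  have e : (1 - (bigLam ε₀ - (bigLam ε₀)⁻¹) * fluxConst α * C) * ∑ k ∈ Finset.range N, J (a + k)
      = ∑ k ∈ Finset.range N, J (a + k)
        - (bigLam ε₀ - (bigLam ε₀)⁻¹) * fluxConst α * C * ∑ k ∈ Finset.range N, J (a + k) := by ring
  rw [e]
  linarith [key]

/-- **Uniform bound on block sums** for a SMALL type-I constant: if
`θ = (Λ − Λ⁻¹)·fluxConst α·C < 1`, every block of shell actions is bounded by
`2Λ·fluxConst α·C·(C·M)/(1−θ)`, `M` the admissible action bound (`∫‖W_n‖² ≤ C·∫‖W_n‖ ≤ C·M`).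
[cite: Tao2016AveragedNS, §4 (4.1)–(4.3), Lemma 4.1 (4.8)–(4.10), §6.4; cell theorem] -/
theorem block_sum_le_const (hε : 0 ≤ ε₀) (hW : IsEternal ε₀ α W) (hc : IsCancellingCoeff α)
    {C : ℝ} (hC : ∀ k σ, ‖W k σ‖ ≤ C)
    (hθ : (bigLam ε₀ - (bigLam ε₀)⁻¹) * fluxConst α * C < 1) :
    ∃ K : ℝ, ∀ (a : ℤ) (N : ℕ), ∑ k ∈ Finset.range N, ∫ σ, ‖W (a + k) σ‖ ^ 2 ≤ K := by
  obtain ⟨M, hM⟩ := hW.action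
  have hC0 : 0 ≤ C := (norm_nonneg _).trans (hC 0 0)
  have hJle : ∀ n : ℤ, ∫ σ, ‖W n σ‖ ^ 2 ≤ C * M := by
    intro n
    calc ∫ σ, ‖W n σ‖ ^ 2 ≤ ∫ σ, C * ‖W n σ‖ := by
          refine integral_mono (integrable_norm_sq hW hC n) ((hM n).1.const_mul C) fun σ => ?_
          simp only [sq]
          exact mul_le_mul_of_nonneg_right (hC n σ) (norm_nonneg _)
      _ = C * ∫ σ, ‖W n σ‖ := integral_const_mul _ _
      _ ≤ C * M := mul_le_mul_of_nonneg_left (hM n).2 hC0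
  have hK0 : 0 ≤ bigLam ε₀ * fluxConst α * C := by
    have h1 : 0 ≤ fluxConst α := (table_sTable α hc).CA_nonneg
    have h2 : 0 ≤ bigLam ε₀ := (bigLam_pos (by linarith)).le
    positivity
  refine ⟨bigLam ε₀ * fluxConst α * C * (C * M + C * M) / (1 - (bigLam ε₀ - (bigLam ε₀)⁻¹) * fluxConst α * C),
    fun a N => ?_⟩
  rw [le_div_iff₀ (by linarith), mul_comm]
  refine (block_sum_le hε hW hc hC a N).trans ?_
  exact mul_le_mul_of_nonneg_left (add_le_add (hJle _) (hJle _)) hK0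

/-- **Small bounded eternal solutions have summable shell actions.**  If the type-I constant `C` of a
bounded admissible inviscid eternal solution of a cancelling table satisfies
`(Λ − Λ⁻¹)·fluxConst α·C < 1`, then `Σ_{n∈ℤ} ∫‖W_n‖² < ∞`.
[cite: Tao2016AveragedNS, §4 (4.1)–(4.3), Lemma 4.1 (4.8)–(4.10), §6.4; cell theorem] -/
theorem summable_action_sq (hε : 0 ≤ ε₀) (hW : IsEternal ε₀ α W) (hc : IsCancellingCoeff α)
    {C : ℝ} (hC : ∀ k σ, ‖W k σ‖ ≤ C)
    (hθ : (bigLam ε₀ - (bigLam ε₀)⁻¹) * fluxConst α * C < 1) :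
    Summable (fun n : ℤ => ∫ σ, ‖W n σ‖ ^ 2) := by
  obtain ⟨K, hK⟩ := block_sum_le_const hε hW hc hC hθ
  have hJ0 : ∀ n : ℤ, 0 ≤ ∫ σ, ‖W n σ‖ ^ 2 := fun n => integral_nonneg fun σ => by positivity
  refine summable_of_sum_le hJ0 (c := K) fun s => ?_
  -- every finite set of shells lies in a block `a, …, a+N-1`
  rcases s.eq_empty_or_nonempty with hs | hs
  · rw [hs, Finset.sum_empty]
    simpa using hK 0 0
  · set a := s.min' hs with ha
    set b := s.max' hs with hb
    set N : ℕ := (b - a).toNat + 1 with hN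
    have hsub : s ⊆ (Finset.range N).image (fun k : ℕ => a + (k : ℤ)) := by
      intro n hn
      rw [Finset.mem_image]
      have h1 : a ≤ n := Finset.min'_le s n hn
      have h2 : n ≤ b := Finset.le_max' s n hn
      refine ⟨(n - a).toNat, ?_, ?_⟩
      · rw [Finset.mem_range, hN]
        have : (n - a).toNat ≤ (b - a).toNat := Int.toNat_le_toNat (by linarith)
        omega
      · rw [Int.toNat_of_nonneg (by linarith)]; ring
    have hinj : Set.InjOn (fun k : ℕ => a + (k : ℤ)) (Finset.range N : Set ℕ) := by
      intro x _ y _ hxy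
      have : (x : ℤ) = y := by simpa using hxy
      exact_mod_cast this
    calc ∑ n ∈ s, ∫ σ, ‖W n σ‖ ^ 2
        ≤ ∑ n ∈ (Finset.range N).image (fun k : ℕ => a + (k : ℤ)), ∫ σ, ‖W n σ‖ ^ 2 :=
          Finset.sum_le_sum_of_subset_of_nonneg hsub fun n _ _ => hJ0 n
      _ = ∑ k ∈ Finset.range N, ∫ σ, ‖W (a + k) σ‖ ^ 2 := Finset.sum_image hinj
      _ ≤ K := hK a N

/-- **Evanescence of small bounded eternal solutions**: under the smallness condition
`(Λ − Λ⁻¹)·fluxConst α·C < 1` the shell actions `∫‖W_n‖²` tend to `0` as `n → ±∞` (cofinite filter)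
— such a solution cannot be a front of asymptotically constant strength fed from `n = −∞`; in
particular an eternal solution carried by a non-trivial DSS wave (constant shell actions) violates the
smallness condition: its type-I constant is `≥ 1/((Λ − Λ⁻¹)·fluxConst α) ≍ ε₀⁻¹`.
[cite: Tao2016AveragedNS, §4 (4.1)–(4.3), Lemma 4.1 (4.8)–(4.10), §6.4; cell theorem] -/
theorem tendsto_action_sq_cofinite (hε : 0 ≤ ε₀) (hW : IsEternal ε₀ α W) (hc : IsCancellingCoeff α)
    {C : ℝ} (hC : ∀ k σ, ‖W k σ‖ ≤ C)
    (hθ : (bigLam ε₀ - (bigLam ε₀)⁻¹) * fluxConst α * C < 1) :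
    Tendsto (fun n : ℤ => ∫ σ, ‖W n σ‖ ^ 2) cofinite (𝓝 0) :=
  (summable_action_sq hε hW hc hC hθ).tendsto_cofinite_zero

end WakeRatchetEternalActionSummable

end Summit.NavierStokesRegularity.NavierStokesRegularity.Theorems

end
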